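import Literature.Computability.Complexity.DegreeThreeEncodingFP
import HarnessLib

/-!
# Randomizing polynomials VIII: the degree-3 encoding of a map is typed polynomial time

The closed forms of file V (`blocksOf`, `usedVars`, `prefixUsed`, `encodeMap_eq`) as `CodeFP`
programs: prefix sums by `take`/`map`/`natSum`, blocks by `map` over `range` with context, and the
raw instance map `(n, P, k) ↦ (n', P', k + (n' - n))`, `(n', P') = encodeMap n P`, between the
codes `pairE natE (pairE (listE (listE (listE natE))) natE)` of `PEA` instances (`codeFP_reduceRaw`).

## References

* S. Arora, B. Barak, *Computational Complexity: A Modern Approach*, CUP 2009, §1.3.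
-/

namespace Literature.Computability.Complexity

namespace RandPoly

open CodeFP (natE pairE rawE listE bitE unE)

-- The specification functions are only ever REWRITTEN with their closed forms here; keeping them
-- irreducible stops the unifier from unfolding them while matching the composed programs.
attribute [local irreducible] ikBlock blocksOf encodeMap

/-! ### List helpers -/

/-- `take` by a binary count (through the unary minimum with the length; as `CodeFPListKit.rawTakeNat`,
re-derived to keep the import cone small). [cite: AroraBarak2009, §1.3] -/
theorem codeFP_takeNat {α : Type} (eα : α → List Bool) :
    CodeFP (pairE natE (rawE eα)) (rawE eα) (fun p => p.2.take p.1) := by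
  have hu : CodeFP (pairE natE (rawE eα)) unE (fun p => min p.1 p.2.length) :=
    CodeFP.unOfNatMin.comp (((CodeFP.ulength eα).comp (CodeFP.snd _ _)).pair (CodeFP.fst _ _))
  refine ((CodeFP.rawTakeUn eα).comp (hu.pair (CodeFP.snd _ _))).congr fun p => ?_
  obtain ⟨k, l⟩ := p
  show l.take (min k l.length) = l.take k
  rcases le_total k l.length with h | h
  · rw [min_eq_left h]
  · rw [min_eq_right h, List.take_length, List.take_of_length_le h]

/-- Dropping the empty monomials. [cite: AroraBarak2009, §1.3] -/
theorem codeFP_filterNe : CodeFP (rawE (rawE natE)) (rawE (rawE natE)) (fun p => p.filter (· ≠ [])) := by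
  have hp : CodeFP (pairE CodeFP.unitE (rawE natE)) bitE (fun c => !c.2.isEmpty) :=
    ((CodeFP.rawIsEmpty natE).comp (CodeFP.snd _ _)).not
  refine ((CodeFP.filter (σ := Unit) (α := List ℕ) hp).comp
    ((CodeFP.const (rawE (rawE natE)) ()).pair (CodeFP.id (rawE (rawE natE))))).congr fun p => ?_
  show p.filter (fun T => !T.isEmpty) = p.filter (fun T => decide (T ≠ []))
  congr 1; funext T; cases T <;> rfl

/-! ### Prefix sums -/

/-- `sizeOf` on codes. [cite: AroraBarak2009, §1.3] -/
theorem codeFP_sizeOf : CodeFP (rawE natE) natE sizeOf :=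
  CodeFP.natAdd.comp (codeFP_blockSize.pair (CodeFP.const (rawE natE) 1))

/-- `prefixSize p j` on codes (argument `(p, j)`). [cite: AroraBarak2009, §1.3] -/
theorem codeFP_prefixSize : CodeFP (pairE (rawE (rawE natE)) natE) natE (fun c => prefixSize c.1 c.2) :=
  (CodeFP.natSum.comp ((CodeFP.map₀ codeFP_sizeOf).comp ((codeFP_takeNat (rawE natE)).comp
    ((CodeFP.snd _ _).pair (CodeFP.fst _ _))))).congr fun _ => rfl

/-- `usedVars` on codes. [cite: AroraBarak2009, §1.3] -/
theorem codeFP_usedVars : CodeFP (rawE (rawE natE)) natE usedVars :=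
  (CodeFP.natSub.comp ((codeFP_prefixSize.comp ((CodeFP.id (rawE (rawE natE))).pair (CodeFP.natLength (rawE natE)))).pair
    (CodeFP.const (rawE (rawE natE)) 1))).congr fun _ => rfl

/-- `startOf n p j` on codes (argument `(n, p, j)`). [cite: AroraBarak2009, §1.3] -/
theorem codeFP_startOf : CodeFP (pairE natE (pairE (rawE (rawE natE)) natE)) natE (fun c => startOf c.1 c.2.1 c.2.2) := by
  let cE := pairE natE (pairE (rawE (rawE natE)) natE)
  have hN : CodeFP cE natE (fun c => c.1) := CodeFP.fst _ _
  have hP : CodeFP cE (rawE (rawE natE)) (fun c => c.2.1) := (CodeFP.snd _ _).fst'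
  have hJ : CodeFP cE natE (fun c => c.2.2) := (CodeFP.snd _ _).snd'
  have hlast : CodeFP cE natE (fun c => if c.2.2 + 1 < c.2.1.length then 1 else 0) :=
    ((CodeFP.natLt.comp ((CodeFP.natAdd.comp (hJ.pair (CodeFP.const _ 1))).pair
      ((CodeFP.natLength (rawE natE)).comp hP))).ite (CodeFP.const _ 1) (CodeFP.const _ 0)).congr fun c => by
        simp only [decide_eq_true_eq]
  exact (CodeFP.natAdd.comp ((CodeFP.natAdd.comp (hN.pair (codeFP_prefixSize.comp (hP.pair hJ)))).pair hlast)).congr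
    fun _ => rfl

/-- `masksOf n [] p j` on codes (argument `(n, p, j)`; no incoming masks at the top level).
[cite: AroraBarak2009, §1.3] -/
theorem codeFP_masksOf : CodeFP (pairE natE (pairE (rawE (rawE natE)) natE)) (rawE natE) (fun c => masksOf c.1 [] c.2.1 c.2.2) := by
  let cE := pairE natE (pairE (rawE (rawE natE)) natE)
  have hN : CodeFP cE natE (fun c => c.1) := CodeFP.fst _ _
  have hP : CodeFP cE (rawE (rawE natE)) (fun c => c.2.1) := (CodeFP.snd _ _).fst'
  have hJ : CodeFP cE natE (fun c => c.2.2) := (CodeFP.snd _ _).snd'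
  have h1 : CodeFP cE (rawE natE) (fun c => if c.2.2 = 0 then [] else [c.1 + prefixSize c.2.1 (c.2.2 - 1)]) :=
    ((CodeFP.natEq.comp (hJ.pair (CodeFP.const _ 0))).ite (CodeFP.const _ [])
      ((CodeFP.rawSingleton natE).comp (CodeFP.natAdd.comp (hN.pair (codeFP_prefixSize.comp (hP.pair
        (CodeFP.natSub.comp (hJ.pair (CodeFP.const _ 1))))))))).congr fun c => by simp only [decide_eq_true_eq]
  have h2 : CodeFP cE (rawE natE) (fun c => if c.2.2 + 1 < c.2.1.length then [c.1 + prefixSize c.2.1 c.2.2] else []) :=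
    ((CodeFP.natLt.comp ((CodeFP.natAdd.comp (hJ.pair (CodeFP.const _ 1))).pair
      ((CodeFP.natLength (rawE natE)).comp hP))).ite
      ((CodeFP.rawSingleton natE).comp (CodeFP.natAdd.comp (hN.pair (codeFP_prefixSize.comp (hP.pair hJ)))))
      (CodeFP.const _ [])).congr fun c => by simp only [decide_eq_true_eq]
  exact ((CodeFP.rawAppend natE).comp (h1.pair h2)).congr fun _ => rfl

/-- **`blocksOf n [] p` on codes** (argument `(n, p)`). [cite: AroraBarak2009, §1.3] -/
theorem codeFP_blocksOf : CodeFP (pairE natE (rawE (rawE natE))) (rawE (rawE (rawE natE))) (fun c => blocksOf c.1 [] c.2) := by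
  let cE := pairE natE (rawE (rawE natE))
  -- item `j` with context `(n, p)`
  have h3 : CodeFP (pairE cE natE) (pairE natE (pairE (rawE (rawE natE)) natE)) (fun c => (c.1.1, c.1.2, c.2)) :=
    (CodeFP.fst _ _).fst'.pair ((CodeFP.fst _ _).snd'.pair (CodeFP.snd _ _))
  have hS : CodeFP (pairE cE natE) natE (fun c => startOf c.1.1 c.1.2 c.2) := codeFP_startOf.comp h3
  have hT : CodeFP (pairE cE natE) (rawE natE) (fun c => c.1.2.getD c.2 []) :=
    (CodeFP.rawGetD (rawE natE) (d := []) rfl).comp ((CodeFP.fst _ _).snd'.pair (CodeFP.snd _ _))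
  have hM : CodeFP (pairE cE natE) (rawE natE) (fun c => masksOf c.1.1 [] c.1.2 c.2) := codeFP_masksOf.comp h3
  have hitem : CodeFP (pairE cE natE) (rawE (rawE (rawE natE)))
      (fun c => ikBlock (startOf c.1.1 c.1.2 c.2) (c.1.2.getD c.2 []) (masksOf c.1.1 [] c.1.2 c.2)) :=
    codeFP_ikBlock.comp (hS.pair (hT.pair hM))
  have hrange : CodeFP cE (rawE natE) (fun c => List.range c.2.length) :=
    CodeFP.urange.comp ((CodeFP.ulength (rawE natE)).comp (CodeFP.snd _ _))
  have hall : CodeFP cE (rawE (rawE (rawE natE))) (fun c => ((List.range c.2.length).map fun j =>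
      ikBlock (startOf c.1 c.2 j) (c.2.getD j []) (masksOf c.1 [] c.2 j)).flatten) :=
    (CodeFP.flatten (rawE (rawE natE))).comp ((CodeFP.map (σ := ℕ × List (List ℕ)) (α := ℕ) hitem).comp
      ((CodeFP.id cE).pair hrange))
  exact hall.congr fun c => by rw [blocksOf, List.flatMap_def]

/-! ### The map level -/

/-- Fresh variables used by a polynomial (after dropping the empty monomials). [cite: AroraBarak2009, §1.3] -/
theorem codeFP_usedOf : CodeFP (rawE (rawE natE)) natE (fun p => usedVars (p.filter (· ≠ []))) :=
  codeFP_usedVars.comp codeFP_filterNe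

/-- `prefixUsed P i` on codes (argument `(P, i)`). [cite: AroraBarak2009, §1.3] -/
theorem codeFP_prefixUsed : CodeFP (pairE (rawE (rawE (rawE natE))) natE) natE (fun c => prefixUsed c.1 c.2) :=
  (CodeFP.natSum.comp ((CodeFP.map₀ codeFP_usedOf).comp ((codeFP_takeNat (rawE (rawE natE))).comp
    ((CodeFP.snd _ _).pair (CodeFP.fst _ _))))).congr fun _ => rfl

/-- **`(encodeMap n P).2` on codes** (argument `(n, P)`). [cite: AroraBarak2009, §1.3] -/
theorem codeFP_encodeMap_snd : CodeFP (pairE natE (rawE (rawE (rawE natE)))) (rawE (rawE (rawE natE))) (fun c => (encodeMap c.1 c.2).2) := by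
  let cE := pairE natE (rawE (rawE (rawE natE)))
  have hC : CodeFP (pairE cE natE) natE (fun c => c.1.1 + prefixUsed c.1.2 c.2) :=
    CodeFP.natAdd.comp ((CodeFP.fst _ _).fst'.pair (codeFP_prefixUsed.comp ((CodeFP.fst _ _).snd'.pair (CodeFP.snd _ _))))
  have hG : CodeFP (pairE cE natE) (rawE (rawE natE)) (fun c => c.1.2.getD c.2 []) :=
    (CodeFP.rawGetD (rawE (rawE natE)) (d := []) rfl).comp ((CodeFP.fst _ _).snd'.pair (CodeFP.snd _ _))
  have hF : CodeFP (pairE cE natE) (rawE (rawE natE)) (fun c => (c.1.2.getD c.2 []).filter (· ≠ [])) := codeFP_filterNe.comp hG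
  have hitem : CodeFP (pairE cE natE) (rawE (rawE (rawE natE)))
      (fun c => blocksOf (c.1.1 + prefixUsed c.1.2 c.2) [] ((c.1.2.getD c.2 []).filter (· ≠ []))) :=
    codeFP_blocksOf.comp (hC.pair hF)
  have hrange : CodeFP cE (rawE natE) (fun c => List.range c.2.length) :=
    CodeFP.urange.comp ((CodeFP.ulength (rawE (rawE natE))).comp (CodeFP.snd _ _))
  have hall : CodeFP cE (rawE (rawE (rawE natE))) (fun c => ((List.range c.2.length).map fun i =>
      blocksOf (c.1 + prefixUsed c.2 i) [] ((c.2.getD i []).filter (· ≠ []))).flatten) :=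
    (CodeFP.flatten (rawE (rawE natE))).comp ((CodeFP.map (σ := ℕ × List (List (List ℕ))) (α := ℕ) hitem).comp
      ((CodeFP.id cE).pair hrange))
  exact hall.congr fun c => by rw [encodeMap_eq, List.flatMap_def]

/-- **`(encodeMap n P).1` on codes** (argument `(n, P)`). [cite: AroraBarak2009, §1.3] -/
theorem codeFP_encodeMap_fst : CodeFP (pairE natE (rawE (rawE (rawE natE)))) natE (fun c => (encodeMap c.1 c.2).1) :=
  (CodeFP.natAdd.comp ((CodeFP.fst _ _).pair (codeFP_prefixUsed.comp ((CodeFP.snd _ _).pair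
    ((CodeFP.natLength (rawE (rawE natE))).comp (CodeFP.snd _ _)))))).congr fun c => by rw [encodeMap_eq]

/-! ### The raw instance map between the codes of `PEA` instances -/

/-- **The raw reduction `(n, P, k) ↦ (n', P', k + (n' - n))`, `(n', P') = encodeMap n P`, is typed
polynomial time** between the codes of `PEA` instances. [cite: AroraBarak2009, §1.3] -/
theorem codeFP_reduceRaw : CodeFP (pairE natE (pairE (listE (listE (listE natE))) natE)) (pairE natE (pairE (listE (listE (listE natE))) natE))
    (fun c => ((encodeMap c.1 c.2.1).1, (encodeMap c.1 c.2.1).2, c.2.2 + ((encodeMap c.1 c.2.1).1 - c.1))) := by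
  -- headed ↔ raw nested lists (three levels), as in `CNFToCMMSA.codeFP_collList`
  have hraw : CodeFP (listE (listE (listE natE))) (rawE (rawE (rawE natE))) id :=
    ((CodeFP.map₀ ((CodeFP.map₀ (CodeFP.rawOfList natE)).comp (CodeFP.rawOfList (listE natE)))).comp
      (CodeFP.rawOfList (listE (listE natE)))).congr fun P => by simp
  have hhead : CodeFP (rawE (rawE (rawE natE))) (listE (listE (listE natE))) id :=
    ((CodeFP.listOfRaw (listE (listE natE))).comp (CodeFP.map₀ ((CodeFP.listOfRaw (listE natE)).comp
      (CodeFP.map₀ (CodeFP.listOfRaw natE))))).congr fun P => by simp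
  have hN : CodeFP (pairE natE (pairE (listE (listE (listE natE))) natE)) natE (fun c => c.1) := CodeFP.fst _ _
  have hP : CodeFP (pairE natE (pairE (listE (listE (listE natE))) natE)) (rawE (rawE (rawE natE))) (fun c => c.2.1) := hraw.comp (CodeFP.snd _ _).fst'
  have hK : CodeFP (pairE natE (pairE (listE (listE (listE natE))) natE)) natE (fun c => c.2.2) := (CodeFP.snd _ _).snd'
  have hN' : CodeFP (pairE natE (pairE (listE (listE (listE natE))) natE)) natE (fun c => (encodeMap c.1 c.2.1).1) := codeFP_encodeMap_fst.comp (hN.pair hP)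
  have hP' : CodeFP (pairE natE (pairE (listE (listE (listE natE))) natE)) (listE (listE (listE natE))) (fun c => (encodeMap c.1 c.2.1).2) :=
    hhead.comp (codeFP_encodeMap_snd.comp (hN.pair hP))
  have hK' : CodeFP (pairE natE (pairE (listE (listE (listE natE))) natE)) natE (fun c => c.2.2 + ((encodeMap c.1 c.2.1).1 - c.1)) :=
    CodeFP.natAdd.comp (hK.pair (CodeFP.natSub.comp (hN'.pair hN)))
  exact (hN'.pair (hP'.pair hK')).congr fun _ => rfl

end RandPoly

end Literature.Computability.Complexity
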